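import Summits.QuantumFields.BalabanUV.Beta.GAN24.DirichletExhaustion
import Literature.MathematicalPhysics.QuantumFieldTheory.Balaban1983to89.T4Rate166StripDirect

/-!
# `BalabanUV.Beta.GAN24.DirichletExhaustionDeltaZ` — binder row G-an2-4 / (CONV-C), part P2, PART 8 = skeleton node S1 (S1.0, S1.a,
# S1.c): Bałaban's `U = 1` effective gauge-field action `Δ_k` ((1.66) of [Balaban1984PropagatorsI]) TYPED AS A KERNEL ON THE BOND INDEX
# SET OF `ℤ^{d+1}`, with its `k`-UNIFORM DECAY and its OPERATOR η-RATE `θ = L⁻²` — inputs (in2) and (in4) of PART 5's `CovInput` DISCHARGED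
# for this object from the t4-ne2-p2 lineage's `ℤ^{d+1}` entry-kernel theorems BY NAME (unit b2b-balaban-gan24-p2, gen 1, v1)

HONEST FRAMING (cell contract, verbatim): «discharging `BetaPertH` makes Bałaban's UV stability UNCONDITIONAL — a real constructive-QFT
result; it is NOT the continuum limit and NOT the Clay problem.»  Skeleton `HOME/b2b-balaban-gan24-p2/gen1/SKELETON-P2.md` node S1.  THE OBJECT
(S1.0): `deltaZ L k (x,α) (y,β) := Σ_{μ≠ν} [ι_{να}ι_{νβ}K^{(L^k)}_{μν;μμ} − ι_{να}ι_{μβ}K_{μν;μν} − ι_{μα}ι_{νβ}K_{μν;νμ} + ι_{μα}ι_{μβ}K_{μν;νν}](x − y)`,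
`K^{(n)}_{μν;ab}(z) = Re latticeKernel (Gsym n μ ν a b) z = T4GaugeActionRatePair.kerRe n μ ν a b z` — VERBATIM the bond-basis dictionary of b05-g9's
`B5Kernel166Decay.inner_eq`/`deltaPol_eq_sum` for the TORUS matrix `B6Cov2156Torus.deltaPol M n` with the torus sums `ksum M n` replaced by the
`ℤ^{d+1}`-Fourier coefficients of the SAME continued symbol `Gsym` (pv17's `B4TorusKernel.torusKernel_descend_eq`: the torus kernel is the
periodisation of the lattice kernel — so `deltaPol` is the periodisation of `deltaZ`, skeleton node S3.a, NOT proved here).  READING (docstring,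
not a theorem): for a finitely supported bond field `B` on `ℤ^{d+1}`, `⟨B, Δ_kB⟩ = Σ_{b,b′} B_b·deltaZ L k b b′·B_{b′}` is (1.66) of
[Balaban1984PropagatorsI] p. 29 («⟨B, Δ_kB⟩ = ½ Σ_{μ,ν} (2π)^{−d}∫dp′ [ … ]⁻¹ |(∂₁B)~_{μν}(p′)|²», printed as a momentum INTEGRAL, i.e. on the
infinite unit lattice) — the identification (1.65) = (1.66) is NOT certified package-wide (same status as `deltaPol`, cf. `B5Bounds167Lattice`).
WHAT IS PROVED (0 sorry): `deltaZ_abs_le` — `k`-UNIFORM DECAY `|deltaZ L k b b′| ≤ c166Z(d)·e^{−kappaZ(d)·|x−y|_∞}`, `c166Z = 4(d+1)²·MG(d+1)`,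
`kappaZ = κ₁₆₆(d+1)/(d+1)` (t4-ne2-p2 `kerRe_decay` = `ratePair_kerFamily2.decay` BY NAME + `|·|_∞ ≤ |·|₁`); `deltaZ_step_abs_le` / **`opClose_deltaZ`** —
the OPERATOR η-RATE `OpClose ℤ^{d+1} (deltaZ L k) (deltaZ L (k+1)) (theta166Z(d)·(L⁻²)^k) kappaZ`, `theta166Z = 32(d+1)²·C166(d+1)` (`ratePair_kerFamily2.rate` BY
NAME): the fields `hΔ` (in2) and `hstep` (in4) of `DirichletExhaustionCovariance.CovInput` FOR BAŁABAN'S `Δ_k` AT `U = 1`, constants explicit in `d`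
(and `θ = L⁻²`).  NOT here: symmetry (S1.b), the elimination `C` (S2), (2.153)/(2.157) on `ℤ^{d+1}` (S3/S4).  «not in print; our proof attempt»;
NOT `BetaPertH`, NOT continuum, NOT Clay.

ABSOLUTE RULE (cell, verbatim): «No internally-minted statement may enter as a cited fact. Every hypothesis is either kernel-proved in this
package or a verbatim quotation of a PUBLISHED theorem with page reference. The manuscript(s) under audit are NOT citable for their own disputed
steps — they are the thing under adjudication; programme-internal (2001/route/tribunal) claims are never citable.»  Everything below is a
definition with a body or a theorem proved from the tree BY NAME; no `Prop` is minted.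
-/

namespace Summit.QuantumFields.BalabanUV.Beta.GAN24.DirichletExhaustionDeltaZ

open Finset Real
open Literature.MathematicalPhysics.QuantumFieldTheory.Balaban1983to89
open B12Sec2to5 (l1 l1_nonneg Decay510)
open B5Symbol166Strip (kappa166 kappa166_pos MG MG_pos)
open T4GaugeActionRatePair (kerRe kerFamily)
open T4Rate166StripDirect (C166 C166_pos ratePair_kerFamily2)
open T4RateAlgebra (RatePair step)
open B4Sect5Exhaustion (K)
open Summit.QuantumFields.BalabanUV.Beta.GAN24.DirichletExhaustion (OpClose)

noncomputable section

variable {d : ℕ}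

/-! ## §1 The object -/

/-- The direction indicator `ι_κ(α) = [κ = α]` (b05-g9's `dirInd`, on `ℤ^{d+1}`). -/
def dirI (κ α : Fin (d + 1)) : ℝ := if κ = α then 1 else 0

/-- `|ι| ≤ 1`. -/
theorem abs_dirI_le (κ α : Fin (d + 1)) : |dirI κ α| ≤ 1 := by
  unfold dirI; split_ifs <;> simp

/-- The `(μ,ν)`-summand of the bond-basis kernel at separation `z`, directions `α, β`, for an entry-kernel family `Kf a b`. -/
def summand (Kf : Fin (d + 1) → Fin (d + 1) → (Fin (d + 1) → ℤ) → ℝ) (μ ν α β : Fin (d + 1)) (z : Fin (d + 1) → ℤ) : ℝ :=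
  dirI ν α * dirI ν β * Kf μ μ z - dirI ν α * dirI μ β * Kf μ ν z - dirI μ α * dirI ν β * Kf ν μ z + dirI μ α * dirI μ β * Kf ν ν z

/-- **Bałaban's `Δ_k` at `U = 1` as a kernel on `ℤ^{d+1} × Fin (d+1)`** (S1.0): `deltaZ L k (x,α) (y,β) = Σ_{μ ≠ ν} summand (K^{(L^k)}_{μν;··}) μ ν α β (x − y)`
with `K^{(n)}_{μν;ab} = kerRe n μ ν a b` (`= Re latticeKernel (Gsym n μ ν a b)`), the `ℤ^{d+1}` twin of `B6Cov2156Torus.deltaPol`.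
[cite: Balaban1984PropagatorsI, (1.66) p.29] -/
def deltaZ (L : ℕ) [NeZero L] (k : ℕ) (p q : K (d + 1) (d + 1)) : ℝ :=
  ∑ μ : Fin (d + 1), ∑ ν : Fin (d + 1),
    if μ = ν then 0 else summand (fun a b => kerFamily (d := d) L μ ν a b k) μ ν p.2 q.2 (p.1 - q.1)

/-- The decay constant `c166Z(d) = 4(d+1)²·MG(d+1)`. -/
def c166Z (d : ℕ) : ℝ := 4 * ((d : ℝ) + 1) ^ 2 * MG (d + 1)

/-- The step constant `theta166Z(d) = 32(d+1)²·C166(d+1)`. -/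
def theta166Z (d : ℕ) : ℝ := 4 * ((d : ℝ) + 1) ^ 2 * (8 * C166 (d + 1))

/-- The common rate `kappaZ(d) = κ₁₆₆(d+1)/(d+1)`. -/
def kappaZ (d : ℕ) : ℝ := kappa166 (d + 1) / ((d : ℝ) + 1)

/-- `kappaZ > 0`. -/
theorem kappaZ_pos (d : ℕ) : 0 < kappaZ d := by unfold kappaZ; have := kappa166_pos (d + 1); positivity

/-! ## §2 Bookkeeping: four terms, sup-distance versus `ℓ¹` -/

/-- `dist x y ≤ |x − y|₁` on `ℤ^{d+1}` (sup-distance versus `ℓ¹`). -/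
theorem dist_le_l1 (x y : Fin (d + 1) → ℤ) : dist x y ≤ l1 (x - y) := by
  refine (dist_pi_le_iff (l1_nonneg (x - y))).2 fun i => ?_
  rw [Int.dist_eq]
  have h : |((x i : ℤ) : ℝ) - (y i : ℝ)| = |(((x - y) i : ℤ) : ℝ)| := by simp [Pi.sub_apply, Int.cast_sub]
  rw [h]
  unfold l1
  exact Finset.single_le_sum (f := fun j => |(((x - y) j : ℤ) : ℝ)|) (fun j _ => abs_nonneg _) (Finset.mem_univ i)

/-- An `ℓ¹`-decay bound is a sup-distance decay bound (`δ ≥ 0`). -/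
theorem exp_l1_le_exp_dist {δ : ℝ} (hδ : 0 ≤ δ) (x y : Fin (d + 1) → ℤ) :
    Real.exp (-δ * l1 (x - y)) ≤ Real.exp (-(δ * dist x y)) :=
  Real.exp_le_exp.mpr (by nlinarith [dist_le_l1 x y])

/-- A uniform entry bound `|Kf a b z| ≤ E` bounds the `(μ,ν)`-summand by `4E`. -/
theorem abs_summand_le {Kf : Fin (d + 1) → Fin (d + 1) → (Fin (d + 1) → ℤ) → ℝ} {E : ℝ} {z : Fin (d + 1) → ℤ}
    (hK : ∀ a b, |Kf a b z| ≤ E) (μ ν α β : Fin (d + 1)) : |summand Kf μ ν α β z| ≤ 4 * E := by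
  have hE : 0 ≤ E := (abs_nonneg _).trans (hK μ μ)
  have t : ∀ a b c e : Fin (d + 1), |dirI a α * dirI b β * Kf c e z| ≤ E := by
    intro a b c e
    rw [abs_mul, abs_mul]
    calc |dirI a α| * |dirI b β| * |Kf c e z| ≤ 1 * 1 * E :=
          mul_le_mul (mul_le_mul (abs_dirI_le _ _) (abs_dirI_le _ _) (abs_nonneg _) zero_le_one) (hK c e) (abs_nonneg _)
            (by norm_num)
      _ = E := by ring
  unfold summand
  have h1 := t ν ν μ μ; have h2 := t ν μ μ ν; have h3 := t μ ν ν μ; have h4 := t μ μ ν ν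
  calc |dirI ν α * dirI ν β * Kf μ μ z - dirI ν α * dirI μ β * Kf μ ν z - dirI μ α * dirI ν β * Kf ν μ z + dirI μ α * dirI μ β * Kf ν ν z|
      ≤ |dirI ν α * dirI ν β * Kf μ μ z| + |dirI ν α * dirI μ β * Kf μ ν z| + |dirI μ α * dirI ν β * Kf ν μ z| +
          |dirI μ α * dirI μ β * Kf ν ν z| := by
        refine (abs_add_le _ _).trans ?_
        refine add_le_add ((abs_sub _ _).trans (add_le_add ((abs_sub _ _).trans le_rfl) le_rfl)) le_rfl
    _ ≤ E + E + E + E := by linarith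
    _ = 4 * E := by ring

/-- A double sum over directions of terms bounded by `B` (zero on the diagonal) is bounded by `(d+1)²·B`. -/
theorem abs_sum_sum_le {f : Fin (d + 1) → Fin (d + 1) → ℝ} {B : ℝ} (hB : 0 ≤ B) (hf : ∀ μ ν, μ ≠ ν → |f μ ν| ≤ B) :
    |∑ μ : Fin (d + 1), ∑ ν : Fin (d + 1), if μ = ν then 0 else f μ ν| ≤ ((d : ℝ) + 1) ^ 2 * B := by
  have hterm : ∀ μ ν : Fin (d + 1), |(if μ = ν then 0 else f μ ν)| ≤ B := by
    intro μ ν; split_ifs with h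
    · simpa using hB
    · exact hf μ ν h
  calc |∑ μ : Fin (d + 1), ∑ ν : Fin (d + 1), if μ = ν then 0 else f μ ν|
      ≤ ∑ μ : Fin (d + 1), |∑ ν : Fin (d + 1), if μ = ν then 0 else f μ ν| := Finset.abs_sum_le_sum_abs _ _
    _ ≤ ∑ μ : Fin (d + 1), ∑ ν : Fin (d + 1), |(if μ = ν then 0 else f μ ν)| :=
        Finset.sum_le_sum fun μ _ => Finset.abs_sum_le_sum_abs _ _
    _ ≤ ∑ _μ : Fin (d + 1), ∑ _ν : Fin (d + 1), B := Finset.sum_le_sum fun μ _ => Finset.sum_le_sum fun ν _ => hterm μ ν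
    _ = ((d : ℝ) + 1) ^ 2 * B := by
        simp only [Finset.sum_const, Finset.card_univ, Fintype.card_fin, nsmul_eq_mul, Nat.cast_add, Nat.cast_one]
        ring

/-! ## §3 (in2): the `k`-uniform decay of `Δ_k` on `ℤ^{d+1}` -/

/-- **(in2) FOR BAŁABAN'S `Δ_k`**: `|deltaZ L k b b′| ≤ c166Z(d)·e^{−kappaZ(d)·|x−y|_∞}` for every `L ≥ 1`, every `k`, all bonds — from t4-ne2-p2's
`ratePair_kerFamily2.decay` (= `kerRe_decay`) BY NAME. -/
theorem deltaZ_abs_le (L : ℕ) [NeZero L] (k : ℕ) (p q : K (d + 1) (d + 1)) :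
    |deltaZ L k p q| ≤ c166Z d * Real.exp (-(kappaZ d * dist p.1 q.1)) := by
  have hE : ∀ μ ν, μ ≠ ν → ∀ a b, |kerFamily (d := d) L μ ν a b k (p.1 - q.1)| ≤
      MG (d + 1) * Real.exp (-(kappaZ d * dist p.1 q.1)) := by
    intro μ ν hμν a b
    have h := (ratePair_kerFamily2 (d := d) L hμν a b).decay k (p.1 - q.1)
    exact h.trans (mul_le_mul_of_nonneg_left (exp_l1_le_exp_dist (kappaZ_pos d).le p.1 q.1) (MG_pos (d + 1)).le)
  have hB : 0 ≤ 4 * (MG (d + 1) * Real.exp (-(kappaZ d * dist p.1 q.1))) := by have := MG_pos (d + 1); positivity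
  unfold deltaZ
  refine (abs_sum_sum_le hB fun μ ν hμν => abs_summand_le (hE μ ν hμν) μ ν p.2 q.2).trans (le_of_eq ?_)
  unfold c166Z; ring

/-! ## §4 (in4): the operator η-rate of `Δ_k` on `ℤ^{d+1}`, `θ = L⁻²` -/

/-- The one-step difference of `deltaZ` is the same combination of the one-step differences of the entry kernels. -/
theorem deltaZ_succ_sub (L : ℕ) [NeZero L] (k : ℕ) (p q : K (d + 1) (d + 1)) :
    deltaZ L (k + 1) p q - deltaZ L k p q =
      ∑ μ : Fin (d + 1), ∑ ν : Fin (d + 1),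
        if μ = ν then 0 else summand (fun a b => step (kerFamily (d := d) L μ ν a b) k) μ ν p.2 q.2 (p.1 - q.1) := by
  unfold deltaZ
  rw [← Finset.sum_sub_distrib]
  refine Finset.sum_congr rfl fun μ _ => ?_
  rw [← Finset.sum_sub_distrib]
  refine Finset.sum_congr rfl fun ν _ => ?_
  split_ifs with h
  · simp
  · simp only [summand, step]; ring

/-- **The one-step bound**: `|deltaZ L (k+1) b b′ − deltaZ L k b b′| ≤ theta166Z(d)·(L⁻²)^k·e^{−kappaZ(d)|x−y|_∞}` — from `ratePair_kerFamily2.rate`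
(= `T4Rate166StripDirect.kerRe_step2`, King's exponent `n⁻²`) BY NAME. -/
theorem deltaZ_step_abs_le (L : ℕ) [NeZero L] (k : ℕ) (p q : K (d + 1) (d + 1)) :
    |deltaZ L (k + 1) p q - deltaZ L k p q| ≤
      theta166Z d * (((L : ℝ) ^ 2)⁻¹) ^ k * Real.exp (-(kappaZ d * dist p.1 q.1)) := by
  have hE : ∀ μ ν, μ ≠ ν → ∀ a b, |step (kerFamily (d := d) L μ ν a b) k (p.1 - q.1)| ≤
      8 * C166 (d + 1) * (((L : ℝ) ^ 2)⁻¹) ^ k * Real.exp (-(kappaZ d * dist p.1 q.1)) := by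
    intro μ ν hμν a b
    have h := (ratePair_kerFamily2 (d := d) L hμν a b).rate k (p.1 - q.1)
    refine h.trans (mul_le_mul_of_nonneg_left (exp_l1_le_exp_dist (kappaZ_pos d).le p.1 q.1) ?_)
    have := C166_pos (d + 1); positivity
  have hB : 0 ≤ 4 * (8 * C166 (d + 1) * (((L : ℝ) ^ 2)⁻¹) ^ k * Real.exp (-(kappaZ d * dist p.1 q.1))) := by
    have := C166_pos (d + 1); positivity
  rw [deltaZ_succ_sub]
  refine (abs_sum_sum_le hB fun μ ν hμν => abs_summand_le (hE μ ν hμν) μ ν p.2 q.2).trans (le_of_eq ?_)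
  unfold theta166Z; ring

/-- **(in4) FOR BAŁABAN'S `Δ_k`: the OPERATOR η-RATE**, `θ = L⁻²`:
`OpClose ℤ^{d+1} (deltaZ L k) (deltaZ L (k+1)) (theta166Z(d)·(L⁻²)^k) (kappaZ d)` for every `L ≥ 1` and every `k`. -/
theorem opClose_deltaZ (L : ℕ) [NeZero L] (k : ℕ) :
    OpClose (Set.univ : Set (Fin (d + 1) → ℤ)) (deltaZ L k) (deltaZ L (k + 1))
      (theta166Z d * (((L : ℝ) ^ 2)⁻¹) ^ k) (kappaZ d) :=
  fun p q _ _ => deltaZ_step_abs_le L k p q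

/-- The two discharged fields of PART 5's `CovInput` for `Δ := deltaZ L`, side by side (with `L⁻²` written `((L:ℝ)^2)⁻¹`). -/
theorem deltaZ_inputs (L : ℕ) [NeZero L] :
    (∀ k (r s : K (d + 1) (d + 1)), |deltaZ L k r s| ≤ c166Z d * Real.exp (-(kappaZ d * dist r.1 s.1))) ∧
    (∀ k, OpClose (Set.univ : Set (Fin (d + 1) → ℤ)) (deltaZ L k) (deltaZ L (k + 1))
      (theta166Z d * (((L : ℝ) ^ 2)⁻¹) ^ k) (kappaZ d)) :=
  ⟨fun k r s => deltaZ_abs_le L k r s, fun k => opClose_deltaZ L k⟩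

end

end Summit.QuantumFields.BalabanUV.Beta.GAN24.DirichletExhaustionDeltaZ
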